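import Summits.NavierStokesRegularity.FluidComputer.PalasekTowerRegisterGlobalAt
import Summits.NavierStokesRegularity.FluidComputer.PalasekTowerFaceLacunarityLaws

/-!
# The τ₁ faces of the register as universal Navier–Stokes constants, VIII: the CERTIFIED UNIT NUMBERS of the level-1 letter at the
# re-tuned rates `TowerRates.tuned = (2^24, 33/32, 12/5, 49/20)` (crux `EpisodeBase`, stmt-NavierStokesRegularity-19179)

Cell `ns-blowup`, seat `ns-palasek-19179-p2` (g5; holder of record of `EpisodeBase` = `EpisodeBaseG`). Sequel of `PalasekTowerFaceLacunarityLaws.lean`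
(p511376: the level-`1` letter in `(Re₀, σ) = (N₀^{β−2}, N₀^{b−1})` for ANY rates) at the record `TowerRates.tuned` of `PalasekTowerRegisterGlobalAt.lean`
(p517439; the PTB tenure planner's item (a), STATUS 2026-08-27T08:23Z). What a numerics / certificate seat reads off for an `EpisodeBaseGAt TowerRates.tuned`-type letter, in the
UNIT VARIABLES of the level-`0` anchor (speed unit `Y₀`, `ν = 1`), as dyadic closed forms with decimal brackets (cf. `PalasekTowerFaceNumbers*.lean` for `wide`):

| quantity (unit variables) | closed form at tuned | bracket | wide |
|---|---|---|---|
| level-`0` core Reynolds number `Re₀ = N₀^{β−2}` | `2^{48/5}` | (776, 776.1) | 5.28 |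
| first lacunarity step `σ = N₁/N₀` | `2^{3/4}` | (1.681, 1.682) | 1.741 |
| speed face `F = Y₁/Y₀` | `2^{21/20}` | (2.070, 2.071) | 2.056 |
| running cap `(5/3)F` | | (3.450, 3.452) | 3.427 |
| gradient face `G = A₁/Y₀²` | `2^{−39/5}` | (0.004486, 0.004489) | 0.678 |
| window `s₀ = w₀Y₀²` | `(9801/40)·log 2·2^{48/5}` | (131700, 131900) | 325.8 |
| window in level-`0` strain times `A₀w₀ = 4b²β log N₀` | `(9801/40)·log 2` | (169.8, 169.9) | 61.7 |
| child core radius `r_c = Y₀/N₁` | `2^{177/20}` | (461, 462) | 3.03 |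
| child circulation `Γ_c = N₁^{β−2}` | `2^{99/10}` | (955, 956) | 6.23 |
| core-survival `κ = r_c²/s₀` | `2^{81/10}/((9801/40) log 2)` | (1.61, 1.62) | 0.0282 |

LABEL: E–C register arithmetic (KERNEL, certified numerics). WHAT THIS IS NOT: not Navier–Stokes evidence — numbers of the REGISTER at a rates record; nothing about any flow,
about `EpisodeBase`, or about a re-based item (none is filed: D-0014).

References: S. Palasek, arXiv:2605.13827 §3 [cite: Palasek2026ElementaryModel, §3.3]; K128 (ns-blowup STATUS 2026-08-27T05:22Z); RE-TUNING BRIEF v1.2c (19179 evidence).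
-/

noncomputable section

namespace Summit.NavierStokesRegularity.FluidComputer.PalasekTowerClayBridge

open Real
open Literature.Analysis.FluidPDE

namespace TowerRates

/-! ## §1 Closed forms at `tuned` -/

/-- `Re₀(tuned) ∈ (776, 776.1)`. [folklore] -/
theorem tuned_Re₀_bounds : 776 < tuned.N₀ ^ (tuned.β - 2) ∧ tuned.N₀ ^ (tuned.β - 2) < 776.1 := by
  rw [tuned_Re₀_eq]
  exact ⟨lt_two_rpow_of_pow_lt (a := 48) (m := 1) (r := 5) (by norm_num) (by norm_num),
    two_rpow_lt_of_pow_lt (by norm_num) (a := 48) (m := 1) (r := 5) (by norm_num) (by norm_num)⟩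

/-- `σ(tuned) ∈ (1.681, 1.682)`. [folklore] -/
theorem tuned_sigma_bounds : 1.681 < tuned.N₀ ^ (tuned.b - 1) ∧ tuned.N₀ ^ (tuned.b - 1) < 1.682 := by
  rw [tuned_sigma_eq]
  exact ⟨lt_two_rpow_of_pow_lt (a := 3) (m := 1) (r := 4) (by norm_num) (by norm_num),
    two_rpow_lt_of_pow_lt (by norm_num) (a := 3) (m := 1) (r := 4) (by norm_num) (by norm_num)⟩

/-- **Speed face at tuned**: `Y₁/Y₀ = σ^{β−1} = 2^{21/20}`. [folklore] -/
theorem tuned_speedFace_eq : tuned.Y 1 / tuned.Y 0 = (2 : ℝ) ^ ((21 : ℝ) / 20) := by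
  rw [tuned.Y_one_div_Y_zero_eq_sigma_rpow, tuned_sigma_eq, ← Real.rpow_mul (by norm_num)]
  simp only [tuned]; norm_num

/-- `Y₁/Y₀ ∈ (2.070, 2.071)` at tuned (so `θc₂ = 2 < F`: the original pins are admissible). [folklore] -/
theorem tuned_speedFace_bounds : 2.070 < tuned.Y 1 / tuned.Y 0 ∧ tuned.Y 1 / tuned.Y 0 < 2.071 := by
  rw [tuned_speedFace_eq]
  exact ⟨lt_two_rpow_of_pow_lt (a := 21) (m := 1) (r := 20) (by norm_num) (by norm_num),
    two_rpow_lt_of_pow_lt (by norm_num) (a := 21) (m := 1) (r := 20) (by norm_num) (by norm_num)⟩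

/-- The running cap `(5/3)·Y₁/Y₀ ∈ (3.450, 3.452)` at tuned. [folklore] -/
theorem tuned_cap_bounds : 3.450 < 5 / 3 * (tuned.Y 1 / tuned.Y 0) ∧ 5 / 3 * (tuned.Y 1 / tuned.Y 0) < 3.452 := by
  obtain ⟨h1, h2⟩ := tuned_speedFace_bounds
  constructor <;> linarith

/-- **Gradient face at tuned**: `A₁/Y₀² = σ^β/Re₀ = 2^{−39/5}`. [folklore] -/
theorem tuned_gradFace_eq : tuned.A 1 / tuned.Y 0 ^ 2 = (2 : ℝ) ^ (-(39 : ℝ) / 5) := by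
  rw [tuned.A_one_div_Y_zero_sq_eq, tuned_sigma_eq, tuned_Re₀_eq, ← Real.rpow_mul (by norm_num),
    ← Real.rpow_sub (by norm_num : (0 : ℝ) < 2)]
  simp only [tuned]; norm_num

/-- `A₁/Y₀² ∈ (0.004486, 0.004489)` at tuned (`= 1/2^{39/5}`, `2^{39/5} ∈ (222.8, 222.9)`). [folklore] -/
theorem tuned_gradFace_bounds : 0.004486 < tuned.A 1 / tuned.Y 0 ^ 2 ∧ tuned.A 1 / tuned.Y 0 ^ 2 < 0.004489 := by
  rw [tuned_gradFace_eq, show (-(39 : ℝ) / 5) = -((39 : ℝ) / 5) by ring, Real.rpow_neg (by norm_num)]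
  have hlo : (222.8 : ℝ) < (2 : ℝ) ^ ((39 : ℝ) / 5) :=
    lt_two_rpow_of_pow_lt (a := 39) (m := 1) (r := 5) (by norm_num) (by norm_num)
  have hhi : (2 : ℝ) ^ ((39 : ℝ) / 5) < 222.9 :=
    two_rpow_lt_of_pow_lt (by norm_num) (a := 39) (m := 1) (r := 5) (by norm_num) (by norm_num)
  have hpos : 0 < (2 : ℝ) ^ ((39 : ℝ) / 5) := by positivity
  constructor
  · rw [lt_inv_comm₀ (by norm_num) hpos]; nlinarith
  · rw [inv_lt_comm₀ hpos (by norm_num)]; nlinarith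

/-- **Window at tuned in unit viscous times**: `s₀ = w₀Y₀² = 4b²β·log N₀·Re₀ = (9801/40)·log 2·2^{48/5}` (`4·(33/32)²·(12/5)·24 = 9801/40 = 245.025`). [folklore] -/
theorem tuned_window_eq : tuned.window 0 * tuned.Y 0 ^ 2 = (9801 / 40) * Real.log 2 * (2 : ℝ) ^ ((48 : ℝ) / 5) := by
  rw [tuned.window_zero_mul_Y_zero_sq, tuned_Re₀_eq, tuned_N₀_eq, Real.log_rpow (by norm_num)]
  simp only [tuned]; norm_num; ring

/-- `s₀(tuned) ∈ (131700, 131900)`. [folklore] -/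
theorem tuned_window_bounds : 131700 < tuned.window 0 * tuned.Y 0 ^ 2 ∧ tuned.window 0 * tuned.Y 0 ^ 2 < 131900 := by
  rw [tuned_window_eq]
  obtain ⟨hRlo, hRhi⟩ : (776 : ℝ) < (2 : ℝ) ^ ((48 : ℝ) / 5) ∧ (2 : ℝ) ^ ((48 : ℝ) / 5) < 776.1 := by
    rw [← tuned_Re₀_eq]; exact tuned_Re₀_bounds
  have hl2lo := Real.log_two_gt_d9
  have hl2hi := Real.log_two_lt_d9
  constructor <;> nlinarith

/-- **Window at tuned in level-`0` strain times**: `A₀w₀ = 4b²β·log N₀ = (9801/40)·log 2 ∈ (169.8, 169.9)` (wide: `61.7`). [folklore] -/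
theorem tuned_window_strain_bounds :
    169.8 < 4 * tuned.b ^ 2 * tuned.β * Real.log tuned.N₀ ∧ 4 * tuned.b ^ 2 * tuned.β * Real.log tuned.N₀ < 169.9 := by
  rw [tuned_N₀_eq, Real.log_rpow (by norm_num)]
  simp only [tuned]
  have hl2lo := Real.log_two_gt_d9
  have hl2hi := Real.log_two_lt_d9
  constructor <;> nlinarith

/-- **Child core radius at tuned**: `Y₀/N₁ = Re₀/σ = 2^{177/20} ∈ (461, 462)`. [folklore] -/
theorem tuned_childRadius_bounds : 461 < tuned.Y 0 / tuned.N 1 ∧ tuned.Y 0 / tuned.N 1 < 462 := by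
  have h : tuned.Y 0 / tuned.N 1 = (2 : ℝ) ^ ((177 : ℝ) / 20) := by
    rw [tuned.Y_zero_div_N_one_eq, tuned_sigma_eq, tuned_Re₀_eq, ← Real.rpow_sub (by norm_num : (0 : ℝ) < 2)]
    norm_num
  rw [h]
  exact ⟨lt_two_rpow_of_pow_lt (a := 177) (m := 1) (r := 20) (by norm_num) (by norm_num),
    two_rpow_lt_of_pow_lt (by norm_num) (a := 177) (m := 1) (r := 20) (by norm_num) (by norm_num)⟩

/-- **Child circulation at tuned**: `N₁^{β−2} = σ^{β−2}·Re₀ = 2^{99/10} ∈ (955, 956)`. [folklore] -/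
theorem tuned_childCirculation_bounds : 955 < tuned.N 1 ^ (tuned.β - 2) ∧ tuned.N 1 ^ (tuned.β - 2) < 956 := by
  have h : tuned.N 1 ^ (tuned.β - 2) = (2 : ℝ) ^ ((99 : ℝ) / 10) := by
    rw [tuned.N_one_rpow_β_sub_two_eq, tuned_sigma_eq, tuned_Re₀_eq, ← Real.rpow_mul (by norm_num),
      ← Real.rpow_add (by norm_num : (0 : ℝ) < 2)]
    simp only [tuned]; norm_num
  rw [h]
  exact ⟨lt_two_rpow_of_pow_lt (a := 99) (m := 1) (r := 10) (by norm_num) (by norm_num),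
    two_rpow_lt_of_pow_lt (by norm_num) (a := 99) (m := 1) (r := 10) (by norm_num) (by norm_num)⟩

/-- **Core-survival number at tuned**: `κ = N₀^{β−2b}/(4b²β log N₀) = 2^{81/10}/((9801/40)·log 2)`. [folklore] -/
theorem tuned_coreSurvival_eq :
    (tuned.Y 0 / tuned.N 1) ^ 2 / (tuned.window 0 * tuned.Y 0 ^ 2) = (2 : ℝ) ^ ((81 : ℝ) / 10) / ((9801 / 40) * Real.log 2) := by
  rw [tuned.coreSurvival_eq, tuned_N₀_eq, ← Real.rpow_mul (by norm_num), Real.log_rpow (by norm_num)]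
  simp only [tuned]; norm_num; ring

/-- `κ(tuned) ∈ (1.61, 1.62)` (wide `0.0282`): the child core outlives the window. [folklore] -/
theorem tuned_coreSurvival_bounds :
    1.61 < (tuned.Y 0 / tuned.N 1) ^ 2 / (tuned.window 0 * tuned.Y 0 ^ 2) ∧
      (tuned.Y 0 / tuned.N 1) ^ 2 / (tuned.window 0 * tuned.Y 0 ^ 2) < 1.62 := by
  rw [tuned_coreSurvival_eq]
  have hlo : (274.3 : ℝ) < (2 : ℝ) ^ ((81 : ℝ) / 10) :=
    lt_two_rpow_of_pow_lt (a := 81) (m := 1) (r := 10) (by norm_num) (by norm_num)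
  have hhi : (2 : ℝ) ^ ((81 : ℝ) / 10) < 274.4 :=
    two_rpow_lt_of_pow_lt (by norm_num) (a := 81) (m := 1) (r := 10) (by norm_num) (by norm_num)
  have hl2lo := Real.log_two_gt_d9
  have hl2hi := Real.log_two_lt_d9
  have hden : 0 < (9801 : ℝ) / 40 * Real.log 2 := by positivity
  constructor
  · rw [lt_div_iff₀ hden]; nlinarith
  · rw [div_lt_iff₀ hden]; nlinarith

end TowerRates

end Summit.NavierStokesRegularity.FluidComputer.PalasekTowerClayBridge

end
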